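import Literature.Probability.Percolation.Percolation
import Mathlib.Algebra.Order.BigOperators.Group.Finset
import HarnessLib

/-!
# No one-shot swap-class certificate for Kozma–Nitzan's Conjecture 1: the 4-cycle obstruction

Kozma–Nitzan (arXiv:2401.12397, p. 3) Conjecture 1: `P(o ↔ b) ≥ P(o ↔ A) · min_{a ∈ A} P(a ↔ b)` on
every finite weighted graph; it implies their Conjecture 3 and hence `θ(p_c) = 0` on `ℤ³`
(tree: `KozmaNitzan2024_thm6_three`). With `R = {o ↔ A, o ↮ b}` and `L = {o ↔ b}` the conjecture
for the target set `A ∪ {b}` reads `P(R) · min_a P(a ↔ b) ≤ P(L) · max_a P(a ↮ b)`, a comparison of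
sums over PAIRS of configurations `(x, y)`. Pairs fall into *swap classes* `(O, D)`
(`O = x ∩ y`, `D = x ∆ y`; the class consists of the pairs `(O ∪ X, O ∪ (D \ X))`, `X ⊆ D`), and
all pairs of one class carry the same product weight for EVERY choice of edge weights. A
**TYPEDOM certificate** (`TypeDomCert`) is a priority `π(x) ≥ 0` on `A` for `x ∈ R` (total mass
`≥ 1`) and a readout `ψ(x') ≥ 0` on `A` for `x' ∈ L` (total mass `≤ 1`) such that, class by
class, the `π`-mass of the pairs `(x, y)` with `x ∈ R` and the certificate vertex joined to `b`
in `y` is at most the `ψ`-mass of the pairs `(x', y')` with `x' ∈ L` and the readout vertex cut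
from `b` in `y'`. Summing the class inequalities against the class weights gives Conjecture 1
for all weights at once; every class-preserving ("Reimer-type") injection of a vertex-certificate
lift of the two sides, and every positive combination of swap-class pair inequalities in such a
lift, is such a certificate (solo seat `solo-CriticalPhenomena-informed`, `paper/sharpest-statement.md`
§5b.2, where the soundness direction is proved on paper).

This file proves, sorry-free, that **no TYPEDOM certificate exists on the 4-cycle**
`o — a₁ — b — a₂ — o` with `A = {a₁, a₂}` (`typeDomCert_cycle4_elim`, `isEmpty_typeDomCert_cycle4`), although Conjecture 1 holds
there (Kozma–Nitzan Thm 2, `|A| = 2`). The obstruction is two swap classes: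
`T₁ = (O = {o a₂}, D = {o a₁, a₁ b})` forces `π(x⋆)(a₁) ≤ 0` and its mirror image `T₂` forces
`π(x⋆)(a₂) ≤ 0` for `x⋆ = {o a₁, o a₂} ∈ R`, contradicting total mass `≥ 1`. Consequently a proof
of Conjecture 1 cannot be a single weight-preserving bijection / swap-class domination; it must
re-pair configurations between steps (as KN's `|A| = 2` proof does with four applications of
the van den Berg–Häggström–Kahn inequality).

Vertices: `o = 0`, `a₁ = 1`, `b = 2`, `a₂ = 3` in `Fin 4`.
-/

noncomputable section

namespace Summit.CriticalPhenomena.PercolationContinuityZ3.Theorems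

open Literature.Probability.Percolation

variable {V : Type*}

/-- The event `R = {o ↔ A} ∖ {o ↔ b}` of the Conjecture-1 comparison. -/
def domEvent (o b : V) (A : Finset V) : Set (BondConfig V) :=
  (⋃ a ∈ A, openConn o a) \ openConn o b

open Classical in
/-- `π`-mass of the swap class `(O, D)`: pairs `(O ∪ X, O ∪ (D \ X))` with `O ∪ X ∈ R`, weighted by
the priority of each certificate vertex `v ∈ A` that is joined to `b` in the partner. -/
def domMass [DecidableEq V] (π : BondConfig V → V → ℝ) (o b : V) (A : Finset V)
    (O D : Finset (Sym2 V)) : ℝ :=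
  ∑ X ∈ D.powerset, ∑ v ∈ A,
    if ((O ∪ X : Finset (Sym2 V)) : BondConfig V) ∈ domEvent o b A ∧
        ((O ∪ (D \ X) : Finset (Sym2 V)) : BondConfig V) ∈ openConn v b
    then π ((O ∪ X : Finset (Sym2 V)) : BondConfig V) v else 0

open Classical in
/-- `ψ`-mass of the swap class `(O, D)`: pairs `(O ∪ X, O ∪ (D \ X))` with `O ∪ X ∈ L = {o ↔ b}`,
weighted by the readout of each vertex `a ∈ A` that is cut from `b` in the partner. -/
def codMass [DecidableEq V] (ψ : BondConfig V → V → ℝ) (o b : V) (A : Finset V)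
    (O D : Finset (Sym2 V)) : ℝ :=
  ∑ X ∈ D.powerset, ∑ a ∈ A,
    if ((O ∪ X : Finset (Sym2 V)) : BondConfig V) ∈ openConn o b ∧
        ((O ∪ (D \ X) : Finset (Sym2 V)) : BondConfig V) ∉ openConn a b
    then ψ ((O ∪ X : Finset (Sym2 V)) : BondConfig V) a else 0

/-- **TYPEDOM certificate** for Conjecture 1 on the edge set `E` with source `o`, sink `b` and
targets `A` (weakest normalisation: priorities of total mass `≥ 1` on `R`, readouts of total mass
`≤ 1` on `L`, and swap-class-wise domination), as a structure carrying the data `π, ψ`. -/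
structure TypeDomCert [DecidableEq V] (E : Finset (Sym2 V)) (o b : V) (A : Finset V) where
  /-- priority of the certificate vertices on `R`-configurations -/
  π : BondConfig V → V → ℝ
  /-- readout weights on `L`-configurations -/
  ψ : BondConfig V → V → ℝ
  π_nonneg : ∀ x v, 0 ≤ π x v
  ψ_nonneg : ∀ x a, 0 ≤ ψ x a
  π_mass : ∀ x : Finset (Sym2 V), x ⊆ E → (x : BondConfig V) ∈ domEvent o b A → 1 ≤ ∑ v ∈ A, π x v
  ψ_mass : ∀ x : Finset (Sym2 V), x ⊆ E → (x : BondConfig V) ∈ openConn o b → ∑ a ∈ A, ψ x a ≤ 1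
  dom_le_cod : ∀ O D : Finset (Sym2 V), Disjoint O D → O ∪ D ⊆ E →
    domMass π o b A O D ≤ codMass ψ o b A O D

/-! ## Reachability bookkeeping for explicit configurations -/

/-- Membership of a cast finset configuration in `openConn` is reachability in its open graph. -/
theorem mem_openConn_coe {x : Finset (Sym2 V)} {u v : V} :
    ((x : BondConfig V) ∈ openConn u v) ↔ (openGraph (x : BondConfig V)).Reachable u v := Iff.rfl

/-- An edge of the configuration gives adjacency in the open graph. -/
theorem adj_of_mem {x : Finset (Sym2 V)} {a c : V} (h : s(a, c) ∈ x) (hne : a ≠ c) :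
    (openGraph (x : BondConfig V)).Adj a c :=
  (openGraph_adj _ _ _).mpr ⟨Finset.mem_coe.mpr h, hne⟩

/-- An edge of the configuration gives `a ↔ c`. -/
theorem reach_of_mem {x : Finset (Sym2 V)} {a c : V} (h : s(a, c) ∈ x) (hne : a ≠ c) :
    (x : BondConfig V) ∈ openConn a c :=
  (adj_of_mem h hne).reachable

/-- A set of vertices closed under the open edges separates: `u ∈ S`, `v ∉ S` gives `u ↮ v`. -/
theorem not_mem_openConn_of_closed {x : Finset (Sym2 V)} (S : Finset V)
    (hS : ∀ a c : V, s(a, c) ∈ x → (a ∈ S ↔ c ∈ S)) {u v : V} (hu : u ∈ S) (hv : v ∉ S) :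
    (x : BondConfig V) ∉ openConn u v := by
  intro h
  obtain ⟨p⟩ := (mem_openConn_coe).mp h
  suffices hmain : ∀ {a c : V} (_ : (openGraph (x : BondConfig V)).Walk a c), a ∈ S → c ∈ S from
    hv (hmain p hu)
  intro a c q
  induction q with
  | nil => exact id
  | cons hadj _ ih =>
      intro ha
      have hmem := ((openGraph_adj _ _ _).mp hadj).1
      exact ih ((hS _ _ (Finset.mem_coe.mp hmem)).mp ha)

/-- Membership in `R`: joined to some `a ∈ A`, cut from `b`. -/
theorem mem_domEvent {ω : BondConfig V} {o b : V} {A : Finset V} :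
    ω ∈ domEvent o b A ↔ (∃ a ∈ A, ω ∈ openConn o a) ∧ ω ∉ openConn o b := by
  simp [domEvent, Set.mem_iUnion]

/-! ## The 4-cycle `0 — 1 — 2 — 3 — 0`, `o = 0`, `b = 2`, `A = {1, 3}` -/

/-- Edge set of the 4-cycle. -/
def cycle4 : Finset (Sym2 (Fin 4)) := {s(0, 1), s(1, 2), s(2, 3), s(0, 3)}

/-- cast of an explicit edge finset on `Fin 4` to a bond configuration (file-local notation) -/
local notation "⟪" x "⟫" => ((x : Finset (Sym2 (Fin 4))) : BondConfig (Fin 4))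
/-- the target pair `A = {1, 3}` (file-local notation) -/
local notation "𝔸" => ({1, 3} : Finset (Fin 4))

section classT1
/-! ### Class `T₁ = (O = {s(0,3)}, D = {s(0,1), s(1,2)})` -/

/-- `x₀ = {s(0,3)} ∈ R`. -/
private theorem T1_x0_dom : ⟪{s(0, 3)} ∪ ∅⟫ ∈ domEvent 0 2 𝔸 := by
  refine mem_domEvent.mpr ⟨⟨3, by simp, reach_of_mem (by simp) (by decide)⟩, ?_⟩
  exact not_mem_openConn_of_closed ({0, 3} : Finset (Fin 4)) (by decide) (by decide) (by decide)

/-- `x⋆ = {s(0,3), s(0,1)} ∈ R`. -/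
private theorem T1_xstar_dom : ⟪{s(0, 3)} ∪ {s(0, 1)}⟫ ∈ domEvent 0 2 𝔸 := by
  refine mem_domEvent.mpr ⟨⟨1, by simp, reach_of_mem (by simp) (by decide)⟩, ?_⟩
  exact not_mem_openConn_of_closed ({0, 1, 3} : Finset (Fin 4)) (by decide) (by decide) (by decide)

/-- `domMass ≥ 1 + π(x⋆)(1)` on `T₁`: the pairs `(x₀, O ∪ D)` (both certificate vertices joined
to `b`) and `(x⋆, {s(0,3), s(1,2)})` (vertex `1` joined to `b`). -/
private theorem T1_dom_ge (π : BondConfig (Fin 4) → Fin 4 → ℝ) (hπ : ∀ x v, 0 ≤ π x v)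
    (hπ1 : ∀ x : Finset (Sym2 (Fin 4)), x ⊆ cycle4 → ⟪x⟫ ∈ domEvent 0 2 𝔸 → 1 ≤ ∑ v ∈ 𝔸, π x v) :
    1 + π ⟪{s(0, 3)} ∪ {s(0, 1)}⟫ 1 ≤ domMass π 0 2 𝔸 {s(0, 3)} {s(0, 1), s(1, 2)} := by
  classical
  unfold domMass
  have hsub : ({∅, {s(0, 1)}} : Finset (Finset (Sym2 (Fin 4)))) ⊆
      ({s(0, 1), s(1, 2)} : Finset (Sym2 (Fin 4))).powerset := by
    intro X hX
    simp only [Finset.mem_insert, Finset.mem_singleton] at hX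
    rcases hX with rfl | rfl <;> simp
  have hx0 := hπ1 ({s(0, 3)} ∪ ∅) (by simp [cycle4]) T1_x0_dom
  rw [Finset.sum_pair (by decide : (1 : Fin 4) ≠ 3)] at hx0
  have h12 : ⟪{s(0, 3)} ∪ ({s(0, 1), s(1, 2)} \ ∅)⟫ ∈ openConn 1 2 := reach_of_mem (by simp) (by decide)
  have h30 : ⟪{s(0, 3)} ∪ ({s(0, 1), s(1, 2)} \ ∅)⟫ ∈ openConn 3 0 := reach_of_mem (by simp) (by decide)
  have h01 : ⟪{s(0, 3)} ∪ ({s(0, 1), s(1, 2)} \ ∅)⟫ ∈ openConn 0 1 := reach_of_mem (by simp) (by decide)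
  have h32 : ⟪{s(0, 3)} ∪ ({s(0, 1), s(1, 2)} \ ∅)⟫ ∈ openConn 3 2 :=
    SimpleGraph.Reachable.trans (SimpleGraph.Reachable.trans h30 h01) h12
  have h12' : ⟪{s(0, 3)} ∪ ({s(0, 1), s(1, 2)} \ {s(0, 1)})⟫ ∈ openConn 1 2 :=
    reach_of_mem (by simp) (by decide)
  refine le_trans ?_ (Finset.sum_le_sum_of_subset_of_nonneg hsub fun X _ _ =>
    Finset.sum_nonneg fun v _ => ?_)
  · rw [Finset.sum_pair (by exact (Finset.singleton_ne_empty _).symm),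
      Finset.sum_pair (by decide : (1 : Fin 4) ≠ 3), Finset.sum_pair (by decide : (1 : Fin 4) ≠ 3),
      if_pos ⟨T1_x0_dom, h12⟩, if_pos ⟨T1_x0_dom, h32⟩, if_pos ⟨T1_xstar_dom, h12'⟩]
    split_ifs <;> linarith [hπ ⟪{s(0, 3)} ∪ {s(0, 1)}⟫ 3]
  · split_ifs <;> simp [hπ]

/-- On `T₁` only `X = D` contributes to `codMass` (otherwise `O ∪ X ∉ L`), and that term is `≤ 1`. -/
private theorem T1_cod_le (ψ : BondConfig (Fin 4) → Fin 4 → ℝ) (hψ : ∀ x a, 0 ≤ ψ x a)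
    (hψ1 : ∀ x : Finset (Sym2 (Fin 4)), x ⊆ cycle4 → ⟪x⟫ ∈ openConn 0 2 → ∑ a ∈ 𝔸, ψ x a ≤ 1) :
    codMass ψ 0 2 𝔸 {s(0, 3)} {s(0, 1), s(1, 2)} ≤ 1 := by
  classical
  unfold codMass
  rw [Finset.sum_eq_single_of_mem ({s(0, 1), s(1, 2)} : Finset (Sym2 (Fin 4)))
    (Finset.mem_powerset.mpr (le_refl _))]
  · have h01 : ⟪{s(0, 3)} ∪ {s(0, 1), s(1, 2)}⟫ ∈ openConn 0 1 := reach_of_mem (by simp) (by decide)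
    have h12 : ⟪{s(0, 3)} ∪ {s(0, 1), s(1, 2)}⟫ ∈ openConn 1 2 := reach_of_mem (by simp) (by decide)
    refine le_trans (Finset.sum_le_sum fun a _ => ?_)
      (hψ1 _ (by intro e he; simp [cycle4] at he ⊢; rcases he with h | h | h <;> simp [h])
        (SimpleGraph.Reachable.trans h01 h12))
    split_ifs <;> simp [hψ]
  · intro X hX hne
    have hXsub : X ⊆ ({s(0, 1), s(1, 2)} : Finset (Sym2 (Fin 4))) := Finset.mem_powerset.mp hX
    have hnotL : ⟪{s(0, 3)} ∪ X⟫ ∉ openConn 0 2 := by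
      have hmiss : s(0, 1) ∉ X ∨ s(1, 2) ∉ X := by
        by_contra hcon
        push Not at hcon
        refine hne (Finset.Subset.antisymm hXsub fun e he => ?_)
        simp only [Finset.mem_insert, Finset.mem_singleton] at he
        rcases he with rfl | rfl
        · exact hcon.1
        · exact hcon.2
      rcases hmiss with h01 | h12
      · -- open edges ⊆ {s(0,3), s(1,2)}: `S = {0,3}` is closed
        refine not_mem_openConn_of_closed ({0, 3} : Finset (Fin 4)) (fun a c hac => ?_)
          (by decide) (by decide)
        have hac' : s(a, c) ∈ ({s(0, 3), s(1, 2)} : Finset (Sym2 (Fin 4))) := by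
          rcases Finset.mem_union.mp hac with h | h
          · simp only [Finset.mem_singleton] at h; simp [h]
          · have := hXsub h
            simp only [Finset.mem_insert, Finset.mem_singleton] at this
            rcases this with h' | h'
            · exact absurd (h' ▸ h) h01
            · simp [h']
        have key : ∀ a c : Fin 4, s(a, c) ∈ ({s(0, 3), s(1, 2)} : Finset (Sym2 (Fin 4))) →
            (a ∈ ({0, 3} : Finset (Fin 4)) ↔ c ∈ ({0, 3} : Finset (Fin 4))) := by decide
        exact key a c hac'
      · -- open edges ⊆ {s(0,3), s(0,1)}: `S = {0,1,3}` is closed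
        refine not_mem_openConn_of_closed ({0, 1, 3} : Finset (Fin 4)) (fun a c hac => ?_)
          (by decide) (by decide)
        have hac' : s(a, c) ∈ ({s(0, 3), s(0, 1)} : Finset (Sym2 (Fin 4))) := by
          rcases Finset.mem_union.mp hac with h | h
          · simp only [Finset.mem_singleton] at h; simp [h]
          · have := hXsub h
            simp only [Finset.mem_insert, Finset.mem_singleton] at this
            rcases this with h' | h'
            · simp [h']
            · exact absurd (h' ▸ h) h12
        have key : ∀ a c : Fin 4, s(a, c) ∈ ({s(0, 3), s(0, 1)} : Finset (Sym2 (Fin 4))) →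
            (a ∈ ({0, 1, 3} : Finset (Fin 4)) ↔ c ∈ ({0, 1, 3} : Finset (Fin 4))) := by decide
        exact key a c hac'
    exact Finset.sum_eq_zero fun a _ => by rw [if_neg (fun h => hnotL h.1)]

end classT1

section classT2
/-! ### Class `T₂ = (O = {s(0,1)}, D = {s(0,3), s(2,3)})`, the mirror image under `1 ↔ 3` -/

/-- `x₀' = {s(0,1)} ∈ R`. -/
private theorem T2_x0_dom : ⟪{s(0, 1)} ∪ ∅⟫ ∈ domEvent 0 2 𝔸 := by
  refine mem_domEvent.mpr ⟨⟨1, by simp, reach_of_mem (by simp) (by decide)⟩, ?_⟩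
  exact not_mem_openConn_of_closed ({0, 1} : Finset (Fin 4)) (by decide) (by decide) (by decide)

/-- `x⋆ = {s(0,1), s(0,3)} ∈ R` (second spelling). -/
private theorem T2_xstar_dom : ⟪{s(0, 1)} ∪ {s(0, 3)}⟫ ∈ domEvent 0 2 𝔸 := by
  refine mem_domEvent.mpr ⟨⟨1, by simp, reach_of_mem (by simp) (by decide)⟩, ?_⟩
  exact not_mem_openConn_of_closed ({0, 1, 3} : Finset (Fin 4)) (by decide) (by decide) (by decide)

/-- `domMass ≥ 1 + π(x⋆)(3)` on `T₂`. -/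
private theorem T2_dom_ge (π : BondConfig (Fin 4) → Fin 4 → ℝ) (hπ : ∀ x v, 0 ≤ π x v)
    (hπ1 : ∀ x : Finset (Sym2 (Fin 4)), x ⊆ cycle4 → ⟪x⟫ ∈ domEvent 0 2 𝔸 → 1 ≤ ∑ v ∈ 𝔸, π x v) :
    1 + π ⟪{s(0, 1)} ∪ {s(0, 3)}⟫ 3 ≤ domMass π 0 2 𝔸 {s(0, 1)} {s(0, 3), s(2, 3)} := by
  classical
  unfold domMass
  have hsub : ({∅, {s(0, 3)}} : Finset (Finset (Sym2 (Fin 4)))) ⊆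
      ({s(0, 3), s(2, 3)} : Finset (Sym2 (Fin 4))).powerset := by
    intro X hX
    simp only [Finset.mem_insert, Finset.mem_singleton] at hX
    rcases hX with rfl | rfl <;> simp
  have hx0 := hπ1 ({s(0, 1)} ∪ ∅) (by simp [cycle4]) T2_x0_dom
  rw [Finset.sum_pair (by decide : (1 : Fin 4) ≠ 3)] at hx0
  have h23 : ⟪{s(0, 1)} ∪ ({s(0, 3), s(2, 3)} \ ∅)⟫ ∈ openConn 2 3 := reach_of_mem (by simp) (by decide)
  have h01 : ⟪{s(0, 1)} ∪ ({s(0, 3), s(2, 3)} \ ∅)⟫ ∈ openConn 0 1 := reach_of_mem (by simp) (by decide)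
  have h03 : ⟪{s(0, 1)} ∪ ({s(0, 3), s(2, 3)} \ ∅)⟫ ∈ openConn 0 3 := reach_of_mem (by simp) (by decide)
  have h32 : ⟪{s(0, 1)} ∪ ({s(0, 3), s(2, 3)} \ ∅)⟫ ∈ openConn 3 2 := SimpleGraph.Reachable.symm h23
  have h12 : ⟪{s(0, 1)} ∪ ({s(0, 3), s(2, 3)} \ ∅)⟫ ∈ openConn 1 2 :=
    SimpleGraph.Reachable.trans (SimpleGraph.Reachable.trans (SimpleGraph.Reachable.symm h01) h03) h32
  have h23' : ⟪{s(0, 1)} ∪ ({s(0, 3), s(2, 3)} \ {s(0, 3)})⟫ ∈ openConn 2 3 :=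
    reach_of_mem (by simp) (by decide)
  have hc3 : ⟪{s(0, 1)} ∪ {s(0, 3)}⟫ ∈ domEvent 0 2 𝔸 ∧
      ⟪{s(0, 1)} ∪ ({s(0, 3), s(2, 3)} \ {s(0, 3)})⟫ ∈ openConn 3 2 :=
    ⟨T2_xstar_dom, SimpleGraph.Reachable.symm h23'⟩
  refine le_trans ?_ (Finset.sum_le_sum_of_subset_of_nonneg hsub fun X _ _ =>
    Finset.sum_nonneg fun v _ => ?_)
  · rw [Finset.sum_pair (by exact (Finset.singleton_ne_empty _).symm),
      Finset.sum_pair (by decide : (1 : Fin 4) ≠ 3), Finset.sum_pair (by decide : (1 : Fin 4) ≠ 3),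
      if_pos ⟨T2_x0_dom, h12⟩, if_pos ⟨T2_x0_dom, h32⟩, if_pos hc3]
    split_ifs <;> linarith [hπ ⟪{s(0, 1)} ∪ {s(0, 3)}⟫ 1]
  · split_ifs <;> simp [hπ]

/-- On `T₂` only `X = D` contributes to `codMass`, and that term is `≤ 1`. -/
private theorem T2_cod_le (ψ : BondConfig (Fin 4) → Fin 4 → ℝ) (hψ : ∀ x a, 0 ≤ ψ x a)
    (hψ1 : ∀ x : Finset (Sym2 (Fin 4)), x ⊆ cycle4 → ⟪x⟫ ∈ openConn 0 2 → ∑ a ∈ 𝔸, ψ x a ≤ 1) :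
    codMass ψ 0 2 𝔸 {s(0, 1)} {s(0, 3), s(2, 3)} ≤ 1 := by
  classical
  unfold codMass
  rw [Finset.sum_eq_single_of_mem ({s(0, 3), s(2, 3)} : Finset (Sym2 (Fin 4)))
    (Finset.mem_powerset.mpr (le_refl _))]
  · have h03 : ⟪{s(0, 1)} ∪ {s(0, 3), s(2, 3)}⟫ ∈ openConn 0 3 := reach_of_mem (by simp) (by decide)
    have h23 : ⟪{s(0, 1)} ∪ {s(0, 3), s(2, 3)}⟫ ∈ openConn 2 3 := reach_of_mem (by simp) (by decide)
    refine le_trans (Finset.sum_le_sum fun a _ => ?_)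
      (hψ1 _ (by intro e he; simp [cycle4] at he ⊢; rcases he with h | h | h <;> simp [h])
        (SimpleGraph.Reachable.trans h03 (SimpleGraph.Reachable.symm h23)))
    split_ifs <;> simp [hψ]
  · intro X hX hne
    have hXsub : X ⊆ ({s(0, 3), s(2, 3)} : Finset (Sym2 (Fin 4))) := Finset.mem_powerset.mp hX
    have hnotL : ⟪{s(0, 1)} ∪ X⟫ ∉ openConn 0 2 := by
      have hmiss : s(0, 3) ∉ X ∨ s(2, 3) ∉ X := by
        by_contra hcon
        push Not at hcon
        refine hne (Finset.Subset.antisymm hXsub fun e he => ?_)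
        simp only [Finset.mem_insert, Finset.mem_singleton] at he
        rcases he with rfl | rfl
        · exact hcon.1
        · exact hcon.2
      rcases hmiss with h03 | h23
      · -- open edges ⊆ {s(0,1), s(2,3)}: `S = {0,1}` is closed
        refine not_mem_openConn_of_closed ({0, 1} : Finset (Fin 4)) (fun a c hac => ?_)
          (by decide) (by decide)
        have hac' : s(a, c) ∈ ({s(0, 1), s(2, 3)} : Finset (Sym2 (Fin 4))) := by
          rcases Finset.mem_union.mp hac with h | h
          · simp only [Finset.mem_singleton] at h; simp [h]
          · have := hXsub h
            simp only [Finset.mem_insert, Finset.mem_singleton] at this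
            rcases this with h' | h'
            · exact absurd (h' ▸ h) h03
            · simp [h']
        have key : ∀ a c : Fin 4, s(a, c) ∈ ({s(0, 1), s(2, 3)} : Finset (Sym2 (Fin 4))) →
            (a ∈ ({0, 1} : Finset (Fin 4)) ↔ c ∈ ({0, 1} : Finset (Fin 4))) := by decide
        exact key a c hac'
      · -- open edges ⊆ {s(0,1), s(0,3)}: `S = {0,1,3}` is closed
        refine not_mem_openConn_of_closed ({0, 1, 3} : Finset (Fin 4)) (fun a c hac => ?_)
          (by decide) (by decide)
        have hac' : s(a, c) ∈ ({s(0, 1), s(0, 3)} : Finset (Sym2 (Fin 4))) := by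
          rcases Finset.mem_union.mp hac with h | h
          · simp only [Finset.mem_singleton] at h; simp [h]
          · have := hXsub h
            simp only [Finset.mem_insert, Finset.mem_singleton] at this
            rcases this with h' | h'
            · simp [h']
            · exact absurd (h' ▸ h) h23
        have key : ∀ a c : Fin 4, s(a, c) ∈ ({s(0, 1), s(0, 3)} : Finset (Sym2 (Fin 4))) →
            (a ∈ ({0, 1, 3} : Finset (Fin 4)) ↔ c ∈ ({0, 1, 3} : Finset (Fin 4))) := by decide
        exact key a c hac'
    exact Finset.sum_eq_zero fun a _ => by rw [if_neg (fun h => hnotL h.1)]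

end classT2

/-- **No TYPEDOM certificate on the 4-cycle** (`o = 0`, `b = 2`, `A = {1, 3}`): one-shot
swap-class domination cannot prove Kozma–Nitzan's Conjecture 1 even where the conjecture holds. -/
theorem typeDomCert_cycle4_elim (c : TypeDomCert cycle4 0 2 𝔸) : False := by
  classical
  obtain ⟨π, ψ, hπ, hψ, hπ1, hψ1, hcls⟩ := c
  have hT1 := hcls {s(0, 3)} {s(0, 1), s(1, 2)} (by decide)
    (by intro e he; simp [cycle4] at he ⊢; rcases he with h | h | h <;> simp [h])
  have hd1 := T1_dom_ge π hπ hπ1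
  have hc1 := T1_cod_le ψ hψ hψ1
  have hT2 := hcls {s(0, 1)} {s(0, 3), s(2, 3)} (by decide)
    (by intro e he; simp [cycle4] at he ⊢; rcases he with h | h | h <;> simp [h])
  have hd2 := T2_dom_ge π hπ hπ1
  have hc2 := T2_cod_le ψ hψ hψ1
  -- the two spellings of `x⋆` denote the same configuration `{s(0,1), s(0,3)}`
  have hx : ⟪{s(0, 3)} ∪ {s(0, 1)}⟫ = ⟪{s(0, 1)} ∪ {s(0, 3)}⟫ := by rw [Finset.union_comm]
  -- normalisation at `x⋆ ∈ R`
  have hnorm := hπ1 ({s(0, 1)} ∪ {s(0, 3)})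
    (by intro e he; simp [cycle4] at he ⊢; rcases he with h | h <;> simp [h]) T2_xstar_dom
  rw [Finset.sum_pair (by decide : (1 : Fin 4) ≠ 3)] at hnorm
  rw [hx] at hd1
  linarith [hπ ⟪{s(0, 1)} ∪ {s(0, 3)}⟫ 1, hπ ⟪{s(0, 1)} ∪ {s(0, 3)}⟫ 3]

/-- The type of TYPEDOM certificates on the 4-cycle is empty. -/
theorem isEmpty_typeDomCert_cycle4 : IsEmpty (TypeDomCert cycle4 0 2 𝔸) :=
  ⟨typeDomCert_cycle4_elim⟩

end Summit.CriticalPhenomena.PercolationContinuityZ3.Theorems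

end
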